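import Summits.Ventures.PercRepro.C026CutVertexB5
import Summits.Ventures.PercRepro.C026PFunCutVertex
import Summits.Ventures.PercRepro.C026PFunCutVertexFree

/-!
# THEOREM L2 reduces to skeletons without a cut vertex (p6, gen 21)

mine-3's block lemma (MINE3-GLUING §39 (d)) as ONE kernel statement.  A **cut vertex** of `G` is a
two-colouring of its edges with both colours present in which every vertex other than `v` is
monochromatic (p5's `IsGluing v v v side`; `HasCutVertex`).  By strong induction on the number of
edges, the corner identity `(E00)` — equivalently THEOREM L2, CONJECTURE (P) at every band state with
two live vertices — holds on every skeleton as soon as it holds on every skeleton without a cut vertex: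

  `pFun_liveCells_nonneg_of_forall_noCutVertex`.

PROOF.  Given a cut vertex `v` with colouring `side`, every mark is `v`, or lies on side `true`, or on
side `false` (`pos_of_isGluing`).  If all three marks are `v` or on one side, that side is a free
factor (`pFun_liveCells_nonneg_iff_of_cut_free`, C026PFunCutVertexFree) and the induction hypothesis
applies to the block.  Otherwise some mark carries an edge of each colour class: the cut vertex then
separates the probe from the live vertices (C026PFunCutVertex, (i)), or a live vertex from the rest
(C026PFunCutVertexB, (ii)), or is the probe between the live vertices (p5's (B5), `slackCF_nonneg_of_cut_c`),
or is a live vertex between the probe and the other live vertex (`slackCF_nonneg_of_cut_live`,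
C026PFunCutVertexFree); the two-colouring is flipped (`isGluing_not`, `onSide_not_iff`) whenever the
lemma of the case is stated for the other orientation.  Every block has fewer edges than `G`
(`Fintype.card_subtype_lt`), so the induction closes.
-/

namespace PercRepro

namespace MultiGraph

open Finset

variable {V E : Type*} {G : MultiGraph V E}

section CutVertexDef

/-- `G` has a cut vertex: a two-colouring of its edges with both colours present, every vertex other
than `v` being incident to edges of one colour only. -/
def HasCutVertex (G : MultiGraph V E) : Prop :=
  ∃ (v : V) (side : E → Bool), G.IsGluing v v v side ∧ (∃ e, side e = true) ∧ (∃ e, side e = false)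

variable {v : V} {side : E → Bool}

/-- Every vertex is the cut vertex, or lies on side `true`, or on side `false`. -/
theorem pos_of_isGluing (hg : G.IsGluing v v v side) (x : V) :
    x = v ∨ G.OnSide side true x ∨ G.OnSide side false x := by
  by_cases hx : x = v
  · exact Or.inl hx
  · by_cases he : ∃ e, G.EdgeAt e x
    · obtain ⟨e, he⟩ := he
      cases hs : side e with
      | false => exact Or.inr (Or.inr fun f hf => (hg x hx hx hx f e hf he).trans hs)
      | true => exact Or.inr (Or.inl fun f hf => (hg x hx hx hx f e hf he).trans hs)
    · exact Or.inr (Or.inl fun f hf => absurd ⟨f, hf⟩ he)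

/-- Flipping the colours keeps the cut vertex. -/
theorem isGluing_not (hg : G.IsGluing v v v side) : G.IsGluing v v v fun e => !side e := by
  intro w h1 h2 h3 e e' he he'
  simp only [hg w h1 h2 h3 e e' he he']

/-- Sides under the flipped colouring. -/
theorem onSide_not_iff {s : Bool} {x : V} :
    G.OnSide (fun e => !side e) s x ↔ G.OnSide side (!s) x := by
  unfold OnSide
  constructor
  · intro h e he
    have := h e he
    cases s <;> cases hse : side e <;> simp_all
  · intro h e he
    have := h e he
    cases s <;> cases hse : side e <;> simp_all

/-- A vertex on side `true` carrying an edge of colour `false` does not exist. -/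
theorem ne_of_onSide_of_not_onSide {s : Bool} {x y : V} (hx : G.OnSide side s x)
    (hy : ¬ G.OnSide side s y) : x ≠ y := by
  rintro rfl
  exact hy hx

end CutVertexDef

section Reduction

universe w

variable [Fintype V] [DecidableEq V]

open Classical in
/-- **THEOREM L2 reduces to skeletons without a cut vertex.** If the corner identity `(E00)` holds on
every skeleton (on the vertex type `V`, edges in one universe) without a cut vertex, it holds on every
skeleton. -/
theorem pFun_liveCells_nonneg_of_forall_noCutVertex
    (H : ∀ (E' : Type w) [Fintype E'] (G' : MultiGraph V E'), ¬ G'.HasCutVertex →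
      ∀ a b c : V, 0 ≤ G'.pFun c (liveCells a b) (liveCells a b) univ)
    {E₀ : Type w} [Fintype E₀] (G : MultiGraph V E₀) (a b c : V) :
    0 ≤ G.pFun c (liveCells a b) (liveCells a b) univ := by
  suffices key : ∀ n : ℕ, ∀ (E' : Type w) [Fintype E'] (G' : MultiGraph V E'),
      Fintype.card E' = n → ∀ a b c : V, 0 ≤ G'.pFun c (liveCells a b) (liveCells a b) univ from
    key _ E₀ G rfl a b c
  intro n
  refine Nat.strong_induction_on n ?_
  intro n ih E' _ G' hn a b c
  by_cases hcut : G'.HasCutVertex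
  · obtain ⟨v, side, hg, ⟨e₁, he₁⟩, ⟨e₂, he₂⟩⟩ := hcut
    -- both blocks have fewer edges
    have hltT : Fintype.card {e // side e = true} < n := by
      rw [← hn]
      exact Fintype.card_subtype_lt (x := e₂) (by simp [he₂])
    have hltF : Fintype.card {e // (fun e => !side e) e = true} < n := by
      rw [← hn]
      exact Fintype.card_subtype_lt (x := e₁) (by simp [he₁])
    -- the induction hypothesis on the two blocks (in this file's instances)
    have ihT : ∀ a' b' c' : V,
        0 ≤ (G'.part side true).pFun c' (liveCells a' b') (liveCells a' b') univ := by
      intro a' b' c'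
      have h := ih _ hltT _ (G'.part side true) rfl a' b' c'
      convert h using 2
    have ihF : ∀ a' b' c' : V,
        0 ≤ (G'.part (fun e => !side e) true).pFun c' (liveCells a' b') (liveCells a' b') univ := by
      intro a' b' c'
      have h := ih _ hltF _ (G'.part (fun e => !side e) true) rfl a' b' c'
      convert h using 2
    have hg' := isGluing_not hg
    -- positions of the marks
    have posa := pos_of_isGluing hg a
    have posb := pos_of_isGluing hg b
    have posc := pos_of_isGluing hg c
    by_cases hT : (a = v ∨ G'.OnSide side true a) ∧ (b = v ∨ G'.OnSide side true b) ∧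
        (c = v ∨ G'.OnSide side true c)
    · -- (iv): side `false` is mark-free
      exact (pFun_liveCells_nonneg_iff_of_cut_free hg hT.1 hT.2.1 hT.2.2).2 (ihT a b c)
    by_cases hF : (a = v ∨ G'.OnSide side false a) ∧ (b = v ∨ G'.OnSide side false b) ∧
        (c = v ∨ G'.OnSide side false c)
    · -- (iv) flipped: side `true` is mark-free
      have hT' : ∀ x, (x = v ∨ G'.OnSide side false x) → (x = v ∨ G'.OnSide (fun e => !side e) true x) :=
        fun x hx => hx.imp id fun h => onSide_not_iff.2 h
      exact (pFun_liveCells_nonneg_iff_of_cut_free hg' (hT' a hF.1) (hT' b hF.2.1)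
        (hT' c hF.2.2)).2 (ihF a b c)
    -- some mark is strictly on side `false`, some mark strictly on side `true`
    simp only [not_and_or, not_or] at hT hF
    -- helper: a mark that is not (`v` or on side `s`) is strictly on the other side
    have strictF : ∀ x, ¬ x = v → ¬ G'.OnSide side true x → G'.OnSide side false x := by
      intro x h1 h2
      rcases pos_of_isGluing hg x with h | h | h
      · exact absurd h h1
      · exact absurd h h2
      · exact h
    have strictT : ∀ x, ¬ x = v → ¬ G'.OnSide side false x → G'.OnSide side true x := by
      intro x h1 h2
      rcases pos_of_isGluing hg x with h | h | h
      · exact absurd h h1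
      · exact h
      · exact absurd h h2
    -- the (E00) of the block via each lemma
    rcases hT with ⟨hav, haT⟩ | ⟨hbv, hbT⟩ | ⟨hcv, hcT⟩ <;>
      rcases hF with ⟨hav', haF⟩ | ⟨hbv', hbF⟩ | ⟨hcv', hcF⟩
    · -- a strictly false and strictly true: impossible
      exact absurd (strictF a hav haT) haF
    · -- a strictly on side false, b strictly on side true
      have haF' := strictF a hav haT
      have hbT' := strictT b hbv' hbF
      have hab : a ≠ b := ne_of_onSide_of_not_onSide hbT' haT |>.symm
      rcases posc with hcv | hcT | hcF
      · -- c is the cut vertex: p5's (B5), with the live vertices swapped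
        subst hcv
        rw [liveCells_comm]
        exact pFun_liveCells_nonneg_of_slackCF b a c
          (slackCF_nonneg_of_cut_c hg hbT' haF' hab.symm)
      · -- b, c on side true, a alone on side false: (ii)
        exact pFun_liveCells_nonneg_of_cut_a hg haF' hbT' hcT hab
          (ne_of_onSide_of_not_onSide hcT haT) (ihT b v c)
      · -- a, c on side false, b alone on side true: (ii) flipped
        exact pFun_liveCells_nonneg_of_cut_b hg' (onSide_not_iff.2 haF') (onSide_not_iff.2 hbT')
          (onSide_not_iff.2 hcF) hab (ne_of_onSide_of_not_onSide hcF hbF) (ihF a v c)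
    · -- a strictly on side false, c strictly on side true
      have haF' := strictF a hav haT
      have hcT' := strictT c hcv' hcF
      have hca : c ≠ a := ne_of_onSide_of_not_onSide hcT' haT
      rcases posb with hbv | hbT | hbF
      · -- b is the cut vertex between a (false) and c (true): live cut vertex `b`, flipped
        subst hbv
        rw [liveCells_comm]
        exact pFun_liveCells_nonneg_of_slackCF _ _ _
          (slackCF_nonneg_of_cut_live hg' (onSide_not_iff.2 haF') (onSide_not_iff.2 hcT') hca)
      · -- b, c on side true, a alone on side false: (ii)
        exact pFun_liveCells_nonneg_of_cut_a hg haF' hbT hcT'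
          (ne_of_onSide_of_not_onSide hbT haT |>.symm) hca (ihT b v c)
      · -- a, b on side false, c alone on side true: (i) flipped
        exact pFun_liveCells_nonneg_of_cut hg' (onSide_not_iff.2 haF') (onSide_not_iff.2 hbF)
          (onSide_not_iff.2 hcT') hca.symm (ne_of_onSide_of_not_onSide hbF hcF) (ihF a b v)
    · -- b strictly on side false, a strictly on side true
      have hbF' := strictF b hbv hbT
      have haT' := strictT a hav' haF
      have hab : a ≠ b := ne_of_onSide_of_not_onSide haT' hbT
      rcases posc with hcv | hcT | hcF
      · -- c is the cut vertex: p5's (B5)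
        subst hcv
        exact pFun_liveCells_nonneg_of_slackCF a b c (slackCF_nonneg_of_cut_c hg haT' hbF' hab)
      · -- a, c on side true, b alone on side false: (ii)
        exact pFun_liveCells_nonneg_of_cut_b hg haT' hbF' hcT hab
          (ne_of_onSide_of_not_onSide hcT hbT) (ihT a v c)
      · -- b, c on side false, a alone on side true: (ii) flipped
        exact pFun_liveCells_nonneg_of_cut_a hg' (onSide_not_iff.2 haT') (onSide_not_iff.2 hbF')
          (onSide_not_iff.2 hcF) hab (ne_of_onSide_of_not_onSide hcF haF) (ihF b v c)
    · -- b strictly false and strictly true: impossible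
      exact absurd (strictF b hbv hbT) hbF
    · -- b strictly on side false, c strictly on side true
      have hbF' := strictF b hbv hbT
      have hcT' := strictT c hcv' hcF
      have hcb : c ≠ b := ne_of_onSide_of_not_onSide hcT' hbT
      rcases posa with hav | haT | haF
      · -- a is the cut vertex between c (true) and b (false): live cut vertex `a`, flipped
        subst hav
        exact pFun_liveCells_nonneg_of_slackCF _ _ _
          (slackCF_nonneg_of_cut_live hg' (onSide_not_iff.2 hbF') (onSide_not_iff.2 hcT') hcb)
      · -- a, c on side true, b alone on side false: (ii)
        exact pFun_liveCells_nonneg_of_cut_b hg haT hbF' hcT'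
          (ne_of_onSide_of_not_onSide haT hbT) hcb (ihT a v c)
      · -- a, b on side false, c alone on side true: (i) flipped
        exact pFun_liveCells_nonneg_of_cut hg' (onSide_not_iff.2 haF) (onSide_not_iff.2 hbF')
          (onSide_not_iff.2 hcT') (ne_of_onSide_of_not_onSide haF hcF) hcb.symm (ihF a b v)
    · -- c strictly on side false, a strictly on side true
      have hcF' := strictF c hcv hcT
      have haT' := strictT a hav' haF
      have hac : a ≠ c := ne_of_onSide_of_not_onSide haT' hcT
      rcases posb with hbv | hbT | hbF
      · -- b is the cut vertex between a (true) and c (false): live cut vertex `b`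
        subst hbv
        rw [liveCells_comm]
        exact pFun_liveCells_nonneg_of_slackCF _ _ _ (slackCF_nonneg_of_cut_live hg haT' hcF' hac.symm)
      · -- a, b on side true, c alone on side false: (i)
        exact pFun_liveCells_nonneg_of_cut hg haT' hbT hcF' hac
          (ne_of_onSide_of_not_onSide hbT hcT) (ihT a b v)
      · -- b, c on side false, a alone on side true: (ii) flipped
        exact pFun_liveCells_nonneg_of_cut_a hg' (onSide_not_iff.2 haT') (onSide_not_iff.2 hbF)
          (onSide_not_iff.2 hcF') (ne_of_onSide_of_not_onSide hbF haF).symm hac.symm (ihF b v c)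
    · -- c strictly on side false, b strictly on side true
      have hcF' := strictF c hcv hcT
      have hbT' := strictT b hbv' hbF
      have hbc : b ≠ c := ne_of_onSide_of_not_onSide hbT' hcT
      rcases posa with hav | haT | haF
      · -- a is the cut vertex between b (true) and c (false): live cut vertex `a`
        subst hav
        exact pFun_liveCells_nonneg_of_slackCF _ _ _ (slackCF_nonneg_of_cut_live hg hbT' hcF' hbc.symm)
      · -- a, b on side true, c alone on side false: (i)
        exact pFun_liveCells_nonneg_of_cut hg haT hbT' hcF'
          (ne_of_onSide_of_not_onSide haT hcT) hbc (ihT a b v)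
      · -- a, c on side false, b alone on side true: (ii) flipped
        exact pFun_liveCells_nonneg_of_cut_b hg' (onSide_not_iff.2 haF) (onSide_not_iff.2 hbT')
          (onSide_not_iff.2 hcF') (ne_of_onSide_of_not_onSide haF hbF) hbc.symm (ihF a v c)
    · -- c strictly false and strictly true: impossible
      exact absurd (strictF c hcv hcT) hcF
  · exact H E' G' hcut a b c

end Reduction

end MultiGraph

end PercRepro
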